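import Literature.NumberTheory.EllipticCurves.IrreducibleModPFrobeniusTraceNeTwoProofs
import Literature.NumberTheory.EllipticCurves.ModPIrreducibleCongruenceTransferProofs
import Literature.NumberTheory.EllipticCurves.SerreOpenImageDeterminantProofs
import Literature.NumberTheory.EllipticCurves.ExceptionalPrimesDensityModels
import Literature.NumberTheory.EllipticCurves.LFunctionSmulProofs
import Literature.NumberTheory.EllipticCurves.GlobalMinimalModelProofs
import HarnessLib

/-!
# Surjective `ρ̄_{E,p}`: good primes `ℓ` outside any finite set whose Frobenius realises a
# PRESCRIBED element of `Aut(E[p]) ≅ GL₂(𝔽_p)` — hence prescribed `ℓ mod p` (determinant) and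
# prescribed `a_ℓ mod p` (trace) — proofs only

Topic `Literature/NumberTheory/EllipticCurves`; namespace `Literature.NumberTheory.EllipticCurves`.
THEOREMS ONLY (no definition, no named fact, no instance).

For an elliptic curve `E = W/ℚ` and a prime `p` with `ρ̄_{E,p} : Γ_ℚ → Aut(E[p])` SURJECTIVE
(`WeierstrassCurve.HasSurjectiveModNGaloisRep`), every automorphism `g` of the `𝔽_p`-plane `E[p]`
is the image of an arithmetic Frobenius at a prime `ℓ` of good reduction outside any prescribed
finite set: Chebotarev's density theorem applied to the open coset `g · ker ρ̄`. Reading off the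
characteristic polynomial of Frobenius (`det ρ̄(Frob_ℓ) = ℓ`, `tr ρ̄(Frob_ℓ) = a_ℓ` modulo `p`,
Serre's (238)) gives primes with PRESCRIBED residue `ℓ mod p` and PRESCRIBED `a_ℓ mod p`:

* `exists_prime_det_eq_trace_eq_of_hasSurjectiveModNGaloisRep` — global minimal form, intrinsic:
  for every `g ∈ Aut(E[p])` and finite `S` there is a prime `ℓ ∉ S`, `ℓ ≠ p`, `ℓ ∤ Δ_min`, with
  `det g = ℓ` and `tr g = a_ℓ(W)` in `𝔽_p` (`g` viewed `𝔽_p`-linearly);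
* `exists_prime_cast_eq_det_lFunction_eq_trace_of_hasSurjectiveModNGaloisRep` — ANY model, matrix
  currency: for every `B ∈ GL₂(𝔽_p)` and finite `S` there is a prime `ℓ ∉ S`, `ℓ ≠ p`, with
  `(ℓ : 𝔽_p) = det B` and `(a_ℓ : 𝔽_p) = tr B`, where `a_ℓ = W.LFunction ℓ` is the `ℓ`-th
  coefficient of `L(E, s)` (model-free: `LFunction_smul`);
* `exists_prime_mod_eq_not_dvd_lFunction_of_hasSurjectiveModNGaloisRep_three` — the `p = 3`
  instance used by cell bsd-stepL (crux `CartanOnePlaceDegreeLawAtThree`, inert-Hecke certificate,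
  print input (CHEB)): `ρ̄_{E,3}` onto ⇒ primes `ℓ ≡ 2 (mod 3)` with `3 ∤ a_ℓ` outside any finite
  set (`B = (0 1; 1 1)`, `det B = -1`, `tr B = 1`).

## Proof (assembly of tree theorems; pattern of `exists_prime_modEq_one_not_dvd_frobeniusTrace_sub_two`)

* surjectivity gives `σ₀ ∈ Γ_ℚ` with `ρ̄(σ₀) = g`; the coset `{σ | ρ̄ σ = ρ̄ σ₀}` is open
  (`isOpen_ker_galoisRepTorsion_holds`) and meets the dense set of arithmetic Frobenius elements at
  places outside `S ∪ {p} ∪ {ℓ ∣ Δ_min}` (Chebotarev: `absoluteGaloisGroup.frobenius_dense` with the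
  PROVED `chebotarev_artinRep_holds`);
* for such a Frobenius `φ` above `ℓ`: `det ρ̄(φ) = ℓ (mod p)` (`det_galoisRepTorsion_frobenius_eq`,
  Weil pairing / `det = χ̄_p`) and `tr ρ̄(φ) = a_ℓ (mod p)` (`trace_galoisRepTorsion_frobenius_eq`,
  Serre's (238));
* any model: pass to a global minimal model `C • W` (`hasGlobalMinimalModel_rat_holds`), transport
  surjectivity (`hasSurjectiveModNGaloisRep_smul`), frame `Aut((C • W)[p]) ≅ GL₂(𝔽_p)` with
  `det`/`tr` compatibility (`exists_addEquiv_mulEquiv_addAut_GL2`), and return to `W` with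
  `LFunction_smul` and `LFunction_apply_prime_eq_frobeniusTrace`.

No summit statement is proved here; consumed (by name) by
`Summits/BirchSwinnertonDyer/.../Theorems/ClassRecordThreeEulerHalvesAtThreeCartanCover*` (the
`ChebotarevSupplyAtThree` input of the inert-Hecke certificate).

## References

* J.-P. Serre, *Propriétés galoisiennes des points d'ordre fini des courbes elliptiques*, Invent.
  math. 15 (1972), §4.1 (`φ_l : G → Aut(E_l) ≅ GL₂(𝔽_l)`), §5.2. [Serre1972]
* J.-P. Serre, *Quelques applications du théorème de densité de Chebotarev*, Publ. Math. IHÉS 54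
  (1981), §8.1 eq. (238) (p. 188). [Serre1981]
* J. Tate, *Global class field theory*, in Cassels–Fröhlich (1967), §2.4. [TateGCFT1967]
-/

noncomputable section

open scoped Classical
open NumberField IsDedekindDomain Field WeierstrassCurve Rat.HeightOneSpectrum

namespace Literature.NumberTheory.EllipticCurves

open Literature.NumberTheory.GaloisRepresentations

/-- `N v = ℓ` for the place `v` of `ℚ` over `ℓ` (a copy of the tree's
`Rat.residueCard_eq_natGenerator`, kept here to keep the imports light). [folklore] -/
private theorem residueCard_eq_coe_primesEquiv₂ (v : HeightOneSpectrum (𝓞 ℚ)) :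
    v.residueCard = ((primesEquiv v : Nat.Primes) : ℕ) := by
  rw [v.residueCard_eq_card_quotient]
  have h : Ideal.span {(natGenerator v : ℤ)} =
      v.asIdeal.map (Rat.IsIntegralClosure.intEquiv (𝓞 ℚ) : 𝓞 ℚ →+* ℤ) :=
    span_natGenerator v
  rw [Nat.card_congr ((Ideal.quotientEquiv _ _ (Rat.IsIntegralClosure.intEquiv (𝓞 ℚ)) h).trans
    (Int.quotientSpanNatEquivZMod _)).toEquiv, Nat.card_zmod]
  rfl

section Minimal

variable (W : WeierstrassCurve ℚ) [W.IsElliptic] [W.IsGloballyMinimal]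

/-- **Surjective `ρ̄_{E,p}`: every `g ∈ Aut(E[p])` is a Frobenius, read off as `(det, tr)`.**
Let `E = W/ℚ` be an elliptic curve in global minimal form and `p` a prime with
`ρ̄_{E,p} : Γ_ℚ → Aut(E[p])` surjective.  For every additive automorphism `g` of `E[p]` and every
finite set `S` of naturals there is a prime `ℓ ∉ S`, `ℓ ≠ p`, `ℓ ∤ Δ_min(W)` (good reduction) with
`det g = ℓ` and `tr g = a_ℓ(W)` in `𝔽_p` (`g` viewed as an `𝔽_p`-linear map of the plane `E[p]`).
Proof: `g = ρ̄(σ₀)` by surjectivity; the open coset `σ₀ · ker ρ̄` contains an arithmetic Frobenius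
`φ` above some `ℓ ∉ S ∪ {p} ∪ {q ∣ Δ_min}` (Chebotarev, `absoluteGaloisGroup.frobenius_dense`); then
`ρ̄(φ) = g`, `det ρ̄(φ) = ℓ` (`det_galoisRepTorsion_frobenius_eq`) and `tr ρ̄(φ) = a_ℓ`
(`trace_galoisRepTorsion_frobenius_eq`, Serre (238)). [cite: Serre1981, §8.1 eq. (238) (p. 188)]
[cite: TateGCFT1967, §2.4 (Tchebotarev density theorem)] [cite: Serre1972, §4.1] -/
theorem exists_prime_det_eq_trace_eq_of_hasSurjectiveModNGaloisRep (p : ℕ) [Fact p.Prime]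
    (hsurj : W.HasSurjectiveModNGaloisRep p) (g : Multiplicative (AddAut (geomTorsion W p)))
    (S : Set ℕ) (hS : S.Finite) :
    letI : Module (ZMod p) (geomTorsion W p) := AddSubgroup.torsionBy.zmodModule
    ∃ ℓ : ℕ, ℓ.Prime ∧ ℓ ∉ S ∧ ℓ ≠ p ∧ ¬ (ℓ : ℤ) ∣ minimalDiscriminantInt W ∧
      LinearMap.det ((Multiplicative.toAdd g).toAddMonoidHom.toZModLinearMap p) = (ℓ : ZMod p) ∧
      LinearMap.trace (ZMod p) (geomTorsion W p)
          ((Multiplicative.toAdd g).toAddMonoidHom.toZModLinearMap p) =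
        (W.frobeniusTrace ℓ : ZMod p) := by
  classical
  letI : Module (ZMod p) (geomTorsion W p) := AddSubgroup.torsionBy.zmodModule
  have hp : p.Prime := Fact.out
  -- surjectivity: `g` is the image of some `σ₀`
  obtain ⟨σ₀, hσ₀⟩ := hsurj g
  -- the open coset `U = {σ | ρ̄ σ = ρ̄ σ₀}`
  let ρ := galoisRepTorsion W p
  have hKρ : IsOpen ((ρ.ker : Subgroup (absoluteGaloisGroup ℚ)) : Set (absoluteGaloisGroup ℚ)) :=
    W.isOpen_ker_galoisRepTorsion_holds (n := (p : ℤ)) (by exact_mod_cast hp.ne_zero)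
  let U : Set (absoluteGaloisGroup ℚ) :=
    (fun σ ↦ σ₀⁻¹ * σ) ⁻¹' ((ρ.ker : Subgroup _) : Set _)
  have hU : IsOpen U := hKρ.preimage (continuous_const.mul continuous_id)
  have hσ₀U : σ₀ ∈ U := by
    change σ₀⁻¹ * σ₀ ∈ ((ρ.ker : Subgroup _) : Set _)
    rw [inv_mul_cancel]
    exact one_mem _
  -- the excluded places
  have hΔ0 : minimalDiscriminantInt W ≠ 0 := minimalDiscriminantInt_ne_zero W
  let S' : Set ℕ := S ∪ {q | q = p ∨ (q : ℤ) ∣ minimalDiscriminantInt W}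
  have hS' : S'.Finite := by
    refine hS.union ((Set.finite_le_nat (max p (minimalDiscriminantInt W).natAbs)).subset ?_)
    rintro q (rfl | hq)
    · exact Set.mem_setOf.mpr (le_max_left _ _)
    · exact Set.mem_setOf.mpr (le_max_of_le_right
        (Nat.le_of_dvd (Int.natAbs_pos.mpr hΔ0) (Int.natCast_dvd.mp hq)))
  let S₀ : Set (HeightOneSpectrum (𝓞 ℚ)) := {v | ((primesEquiv v : Nat.Primes) : ℕ) ∈ S'}
  have hS₀ : S₀.Finite := by
    refine Set.Finite.preimage (f := fun v : HeightOneSpectrum (𝓞 ℚ) ↦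
      ((primesEquiv v : Nat.Primes) : ℕ)) (Set.injOn_of_injective ?_) hS'
    intro v w hvw
    exact (primesEquiv (R := 𝓞 ℚ)).injective (Subtype.ext hvw)
  -- Chebotarev: a Frobenius in `U` above a place outside `S₀`
  obtain ⟨φ, hφU, v, hvS₀, 𝔓, h𝔓, hφ⟩ :=
    (absoluteGaloisGroup.frobenius_dense Automorphic.chebotarev_artinRep_holds ℚ S₀ hS₀)
      |>.inter_open_nonempty U hU ⟨σ₀, hσ₀U⟩
  have hρφ : ρ σ₀ = ρ φ := inv_mul_eq_one.mp (by rw [← map_inv, ← map_mul]; exact hφU)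
  set ℓ : ℕ := ((primesEquiv v : Nat.Primes) : ℕ) with hℓ_def
  have hℓ : ℓ.Prime := (primesEquiv v).2
  haveI : Fact ℓ.Prime := ⟨hℓ⟩
  have hℓS' : ℓ ∉ S' := hvS₀
  have hℓS : ℓ ∉ S := fun h ↦ hℓS' (Or.inl h)
  have hℓp : ℓ ≠ p := fun h ↦ hℓS' (Or.inr (Or.inl h))
  have hℓΔ : ¬ (ℓ : ℤ) ∣ minimalDiscriminantInt W := fun h ↦ hℓS' (Or.inr (Or.inr h))
  have hgood : W.HasGoodReductionAtPrime ℓ := hasGoodReductionAtPrime_of_not_dvd W ℓ hℓΔ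
  -- `det ρ̄(φ) = ℓ` and `tr ρ̄(φ) = a_ℓ` modulo `p`, and `ρ̄(φ) = ρ̄(σ₀) = g`
  have hdet := W.det_galoisRepTorsion_frobenius_eq p (p := ℓ) hℓp hgood hℓ_def.symm h𝔓 hφ
  have htr := W.trace_galoisRepTorsion_frobenius_eq p (p := ℓ) hℓp hgood hℓ_def.symm h𝔓 hφ
  have hg : galoisRepTorsion W p φ = g := by rw [← hσ₀]; exact hρφ.symm
  rw [hg] at hdet htr
  exact ⟨ℓ, hℓ, hℓS, hℓp, hℓΔ, hdet, htr⟩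

end Minimal

section AnyModel

variable (W : WeierstrassCurve ℚ) [W.IsElliptic]

/-- **Surjective `ρ̄_{E,p}`, any model, matrix currency: primes with prescribed `ℓ mod p` and
prescribed `a_ℓ mod p`.**  Let `E = W/ℚ` be an elliptic curve (any Weierstrass model) and `p` a
prime with `ρ̄_{E,p}` surjective.  For every `B ∈ GL₂(𝔽_p)` and every finite set `S` of naturals
there is a prime `ℓ ∉ S`, `ℓ ≠ p`, with `(ℓ : 𝔽_p) = det B` and `(a_ℓ : 𝔽_p) = tr B`, where
`a_ℓ = W.LFunction ℓ` is the `ℓ`-th coefficient of `L(E, s)`.  Proof: pass to a global minimal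
model `C • W` (`hasGlobalMinimalModel_rat_holds`; surjectivity and `L(E,s)` are model-free,
`hasSurjectiveModNGaloisRep_smul`, `LFunction_smul`), frame `Aut(E[p]) ≅ GL₂(𝔽_p)` compatibly with
`det` and `tr` (`exists_addEquiv_mulEquiv_addAut_GL2`, Serre 1972 §4.1), apply
`exists_prime_det_eq_trace_eq_of_hasSurjectiveModNGaloisRep` to `g = Φ⁻¹ B`, and use
`a_ℓ = W.LFunction ℓ` at the good prime `ℓ` (`LFunction_apply_prime_eq_frobeniusTrace`).
[cite: Serre1981, §8.1 eq. (238) (p. 188)] [cite: TateGCFT1967, §2.4 (Tchebotarev density theorem)]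
[cite: Serre1972, §4.1] -/
theorem exists_prime_cast_eq_det_lFunction_eq_trace_of_hasSurjectiveModNGaloisRep
    (p : ℕ) [Fact p.Prime] (hsurj : W.HasSurjectiveModNGaloisRep p)
    (B : GL (Fin 2) (ZMod p)) (S : Set ℕ) (hS : S.Finite) :
    ∃ ℓ : ℕ, ℓ.Prime ∧ ℓ ∉ S ∧ ℓ ≠ p ∧
      (ℓ : ZMod p) = Matrix.det (B : Matrix (Fin 2) (Fin 2) (ZMod p)) ∧
      (W.LFunction ℓ : ZMod p) = Matrix.trace (B : Matrix (Fin 2) (Fin 2) (ZMod p)) := by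
  classical
  have hp : p.Prime := Fact.out
  -- a global minimal model `W' = C • W`
  obtain ⟨C, hmin⟩ := hasGlobalMinimalModel_rat_holds W
  set W' : WeierstrassCurve ℚ := C • W with hW'
  haveI : W'.IsElliptic := by rw [hW']; infer_instance
  haveI : W'.IsGloballyMinimal := hmin
  have hsurj' : W'.HasSurjectiveModNGaloisRep p := hasSurjectiveModNGaloisRep_smul W C p hsurj
  -- frame `Aut(E[p]) ≅ GL₂(𝔽_p)` with `det`/`tr` compatibility
  letI : Module (ZMod p) (geomTorsion W' p) := AddSubgroup.torsionBy.zmodModule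
  have hcard : Nat.card (geomTorsion W' p) = p ^ 2 :=
    card_torsionPoints_eq_sq_holds W' (AlgebraicClosure ℚ) (n := p)
      (Nat.cast_ne_zero.mpr hp.ne_zero)
  obtain ⟨e, Φ, -, htr, hdet⟩ := exists_addEquiv_mulEquiv_addAut_GL2 (geomTorsion W' p) hcard
  -- the prescribed automorphism `g = Φ⁻¹ B`
  obtain ⟨ℓ, hℓ, hℓS, hℓp, hℓΔ, hdetg, htrg⟩ :=
    exists_prime_det_eq_trace_eq_of_hasSurjectiveModNGaloisRep W' p hsurj' (Φ.symm B) S hS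
  haveI : Fact ℓ.Prime := ⟨hℓ⟩
  refine ⟨ℓ, hℓ, hℓS, hℓp, ?_, ?_⟩
  · rw [← hdetg, ← hdet (Φ.symm B), MulEquiv.apply_symm_apply]
  · have hL : W.LFunction ℓ = W'.frobeniusTrace ℓ := by
      rw [← LFunction_apply_prime_eq_frobeniusTrace W' ℓ
        (hasGoodReductionAtPrime_of_not_dvd W' ℓ hℓΔ), hW', LFunction_smul W C]
    rw [hL, ← htrg, ← htr (Φ.symm B), MulEquiv.apply_symm_apply]

/-- **`ρ̄_{E,3}` onto `GL₂(𝔽₃)` ⇒ primes `ℓ ≡ 2 (mod 3)` with `3 ∤ a_ℓ(E)` outside any finite set**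
(the shape of print input (CHEB) of cell bsd-stepL's inert-Hecke certificate,
`…CartanCover.Charext.InertHecke.ChebotarevSupplyAtThree`): `GL₂(𝔽₃) ∋ B = (0 1; 1 1)` has
`det B = -1` and `tr B = 1`, so `exists_prime_cast_eq_det_lFunction_eq_trace_of_hasSurjectiveModNGaloisRep`
gives `ℓ ≡ -1 (mod 3)` and `a_ℓ ≡ 1 (mod 3)`.
[cite: Serre1981, §8.1 eq. (238) (p. 188)] [cite: Serre1972, §4.1] -/
theorem exists_prime_mod_eq_not_dvd_lFunction_of_hasSurjectiveModNGaloisRep_three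
    (hsurj : W.HasSurjectiveModNGaloisRep 3) (S : Set ℕ) (hS : S.Finite) :
    ∃ ℓ : ℕ, ℓ.Prime ∧ ℓ ∉ S ∧ ℓ % 3 = 2 ∧ ¬ (3 : ℤ) ∣ W.LFunction ℓ := by
  -- `B = (0 1; 1 1) ∈ GL₂(𝔽₃)`: `det B = -1`, `tr B = 1` (`Fact (Nat.Prime 3)` is a Mathlib instance)
  let B : GL (Fin 2) (ZMod 3) :=
    Matrix.GeneralLinearGroup.mkOfDetNeZero !![0, 1; 1, 1] (by rw [Matrix.det_fin_two_of]; decide)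
  have hBdet : Matrix.det (B : Matrix (Fin 2) (Fin 2) (ZMod 3)) = -1 := by
    rw [show (B : Matrix (Fin 2) (Fin 2) (ZMod 3)) = !![0, 1; 1, 1] from rfl, Matrix.det_fin_two_of]
    decide
  have hBtr : Matrix.trace (B : Matrix (Fin 2) (Fin 2) (ZMod 3)) = 1 := by
    rw [show (B : Matrix (Fin 2) (Fin 2) (ZMod 3)) = !![0, 1; 1, 1] from rfl, Matrix.trace_fin_two_of]
    decide
  obtain ⟨ℓ, hℓ, hℓS, -, hℓdet, hℓtr⟩ :=
    exists_prime_cast_eq_det_lFunction_eq_trace_of_hasSurjectiveModNGaloisRep W 3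
      (by exact_mod_cast hsurj) B S hS
  refine ⟨ℓ, hℓ, hℓS, ?_, ?_⟩
  · -- `(ℓ : 𝔽₃) = -1 = 2`
    rw [hBdet] at hℓdet
    have h : ((ℓ : ℕ) : ZMod 3) = ((2 : ℕ) : ZMod 3) := by rw [hℓdet]; rfl
    rw [ZMod.natCast_eq_natCast_iff'] at h
    simpa using h
  · -- `(a_ℓ : 𝔽₃) = 1 ≠ 0`
    intro hdvd
    rw [hBtr] at hℓtr
    have h0 : (W.LFunction ℓ : ZMod 3) = 0 := (ZMod.intCast_zmod_eq_zero_iff_dvd _ 3).mpr hdvd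
    rw [h0] at hℓtr
    exact zero_ne_one hℓtr

end AnyModel

end Literature.NumberTheory.EllipticCurves

end
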